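import Literature.Computability.AlgebraicComplexity.DDS21DiDILCompanion
import Literature.Computability.AlgebraicComplexity.DDS21GenOneABP
import HarnessLib

/-!
# Dutta–Dwivedi–Saxena 2021, §3, Claim 3.8: the `z = 0` SLICE of a DiDIL stage has small ABPs
# (brick `exists_sliceZero_programs` of the `DDS2021_thm_3_2` programme "M-b", RULING (166))

Theorem-only companion (cell `val-lit`, np lane; owner t21 g13 per lead-np RULING (166); consumer
x5 g8's `DDS21ResidueChainExists.lean`, signature posted HOME bus 2026-08-27 21:08Z) for P. Dutta,
P. Dwivedi, N. Saxena, *Demystifying the border of depth-3 algebraic circuits*, FOCS 2021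
[DuttaDwivediSaxena2022], held full version `paper:galaxy-pdf-7641649743695546420` (chunk
`pNNNN.txt`, printed line `Lnnn`).

## What is proved (no definitions, no named facts)

Claim 3.8 (p0035 L934–939): "`(f_j/t_{k−j,j})|_{z=0} = lim_{ε→0} Σ_i (T_{i,j}/T̃_{k−j,j})|_{z=0}`
`= lim_{ε→0} Σ_i (ε^{-a}·U·V/(U·V) · P·Q/(P·Q))|_{z=0} ∈ lim_{ε→0} Σ_i F(ε)·(Σ∧Σ/Σ∧Σ)`
`= lim (Σ∧Σ/Σ∧Σ) ⊆ ARO/ARO ⊆ ABP/ABP` of size `s^{O(k 7^k)}`". In the tree's exact/graded frame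
(B4b's `ExactTerm` records over `F′(ε)`, generic point `(A′)`), for a well-formed stage family `G`
with nondegenerate divisor `G i₀`, companion invariant (`DDS21DiDILCompanion.StageComp`),
`Σ∧Σ` certificates (`Cert N t`, sizes `Bdd B`, `B < N`) and the Claim-3.8 datum
`lim (λ·(Σ_i T_i)/T_{i₀}) = r` of `DDS21TranscriptResidues.didil_round`:

* §1 `initialForm_eq_C_mul_gcomp`: the `x`-initial form of a numerator is the certified graded
  piece at its lowest degree, `in(p) = Π(0) · gcomp p Π (ldeg p)` — so `in(𝒫.p) ∈ Σ∧Σ(t)`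
  (`initialForm_mem_swsClass_of_cert`); `ExactTerm.initialForm_numPoly/denPoly`: the initial
  forms of B4b's cleared polynomials are CONSTANTS times `in(𝒫.p)`, `in(𝒬.p)` (all affine forms
  have nonzero constant terms, "`U|_{z=0} ∈ F(ε)∖{0}`").
* §2 ★ UNIFORM `𝒬`: along the DiDIL run ALL terms of a stage carry the SAME `𝒬`-record
  (`didilStep` builds the new `𝒬` from the old one and the divisor's `𝒫` only — brick B4b v5's
  accessors `didilStep_Q`/`didilStep_Q_eq`/`didilIter_Q_eq(_of_ofLiveTerm)`, cited by name; stage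
  `0` has `𝒬 = 1`), here only the stage-`0` family form `uniformQ_of_ofLiveTerm` and the
  sigma-typed run form `uniformQ_run` (round shape of `DDS21TranscriptResidues.exists_didil_run`).
* §3 hence the `z = 0` pieces simplify: `(T_i/T_{i₀})|_{z=0} = C r_i · in(P_i)/in(P_{i₀})`
  (`exists_gradeZero_piece`), and the stage slice is ONE quotient of `Σ∧Σ` circuits,
  `(λ·(Σ_i T_i)/T_{i₀})|_{z=0} = (C λ · Σ_i C r_i · in(P_i)) / in(P_{i₀})` with numerator in
  `swsClass ((m+1)·t) B` and denominator in `swsClass t B` (`exists_gradeZero_slice_sws`) — the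
  print's "`∈ Σ_i F(ε)·(Σ∧Σ/Σ∧Σ)`" with NO product blow-up.
* §4 ★★ `exists_sliceZero_programs`: `lim_{ε→0}` of the slice exists (`epsLim_gradeZero_stage'`),
  is `(lim Y)|_{z=0}` and — de-bordering the quotient by `border_div_swsClass` ("`lim(Σ∧Σ/Σ∧Σ) ⊆
  \overline{Σ∧Σ}/\overline{Σ∧Σ}`") and Lemma 2.23 (`uabpComputes_of_mem_border_swsClass`) — equals
  `Nw/ew` with `Nw, ew ∈ F′[x]` computed by univariate-labelled ABPs within the EXPLICIT budget
  `(n+1)((m+1)t((n+1)B+1)) + B + 4` and of total degree `≤ B`; `exists_sliceZero_programs_le`: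
  the consumer's `σ`-form — programs and degrees `≤ σ^15` under `2 ≤ σ`, `n + 1 ≤ σ`, `t ≤ σ`,
  `B ≤ σ`, `m + 1 ≤ σ` (the exponent `15` is ABSOLUTE, independent of the number of terms).

Typed vs printed: print's size is the unquantified "`s^{O(k7^k)}`"; here the budget is explicit and
POLYNOMIAL in `(n, t, B, m)` because of §2 (the print multiplies out a common denominator of up to
`k` `Σ∧Σ` factors, "`Σ∧Σ` is closed under constant-fold multiplication", p0036 L938–943 — not
needed). Honest framing: bookkeeping for a published 2021 theorem; `DDS2021_thm_3_2` remains an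
OPEN named fact until the composition lands; VP ≠ VNP is NOT proved and nothing here bears on it.

## References

* [DuttaDwivediSaxena2022] P. Dutta, P. Dwivedi, N. Saxena, *Demystifying the border of depth-3
  algebraic circuits*, Proc. 62nd FOCS (2021), IEEE 2022, 92–103; full version
  `paper:galaxy-pdf-7641649743695546420`: Claim 3.8 with proof p0035 L934–941; the limit step
  p0036 L938–943; Lemma 2.23 p0025 L661–664; induction hypotheses (2)–(3) p0030 L801–805;
  Divide and Derive p0030 L808–812, p0031 L815–817.
-/

noncomputable section

open MvPolynomial
open scoped BigOperators Polynomial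

namespace Literature.Computability.AlgebraicComplexity

namespace DDS2021

open Literature.RingTheory.MvPolynomial

/-! ## §1 Initial forms of certified numerators and of the cleared polynomials -/

section InitialForms

variable {K : Type*} [Field K] {n : ℕ}

/-- The truncated inverse has constant coefficient `Q(0)⁻¹`. (folklore)
[cite: DuttaDwivediSaxena2022, Claim 3.3 proof "1/(1 − A_i) … inverse … mod" (full version p0027 L740–744)] -/
theorem coeff_zero_invJet (c : ℕ) (Q : MvPolynomial (Fin n) K) :
    coeff 0 (invJet c Q) = (coeff 0 Q)⁻¹ := by
  change constantCoeff (invJet c Q) = (constantCoeff Q)⁻¹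
  rw [invJet, map_sum]
  simp only [map_mul, map_pow, map_sub, constantCoeff_C]
  simp only [show coeff 0 Q = constantCoeff Q from rfl, sub_self]
  rw [Finset.sum_eq_single 0 (fun i _ hi => by rw [zero_pow hi, mul_zero])
    (fun h0 => absurd (Finset.mem_range.mpr (Nat.succ_pos c)) h0)]
  rw [pow_zero, mul_one, zero_add, pow_one]

/-- ★ **The initial form is the lowest certified graded piece**: for `Π(0) ≠ 0`,
`in_x(p) = C(Π(0)) · gcomp p Π (ldeg p)` — the degree-`ldeg p` piece of `p/Π` is `in(p)/Π(0)`
because `p` vanishes below `ldeg p`. Hence certified numerators have `Σ∧Σ` initial forms.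
[cite: DuttaDwivediSaxena2022, Claim 3.8 proof, "(…·P·Q/(P·Q))|_{z=0} ∈ F(ε)·(Σ∧Σ/Σ∧Σ)" (full version p0035 L938–939)] -/
theorem initialForm_eq_C_mul_gcomp {p Q : MvPolynomial (Fin n) K} (hQ : coeff 0 Q ≠ 0) :
    initialForm p = C (coeff 0 Q) * gcomp p Q (ldeg p) := by
  have h := homogeneousComponent_mul_of_vanishing (vanishing_ldeg p) (n := 0)
    (Q := invJet (ldeg p) Q) (fun d hd => absurd hd (Nat.not_lt_zero _))
  rw [add_zero] at h
  rw [gcomp_eq_homogeneousComponent_mul_invJet hQ, h, homogeneousComponent_zero, coeff_zero_invJet,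
    mul_comm (homogeneousComponent (ldeg p) p), ← mul_assoc, ← C_mul, mul_inv_cancel₀ hQ, C_1, one_mul,
    initialForm]

/-- **Certified numerators have `Σ∧Σ` initial forms**: if `𝒫 = p/Π` is `Σ∧Σ(t)`-certified below
degree `N > ldeg p` then `in(p) ∈ Σ∧Σ(t, ldeg p)`.
[cite: DuttaDwivediSaxena2022, Claim 3.8 proof (full version p0035 L938–939); Claim 3.6 (p0032 L848–850)] -/
theorem initialForm_mem_swsClass_of_cert {P : FracPair K n} {N t : ℕ} (h : P.Cert N t)
    (hN : ldeg P.p < N) : initialForm P.p ∈ swsClass K n t (ldeg P.p) := by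
  rw [initialForm_eq_C_mul_gcomp P.coeff_zero_den_ne_zero, ← FracPair.gc_def]
  exact C_mul_mem_swsClass _ (h _ hN)

/-- A polynomial with nonzero constant term is its own constant at `z = 0`: `in(f) = C (f(0))`.
(folklore) [cite: DuttaDwivediSaxena2022, §3 induction hypothesis (3) "U|_{z=0} ∈ F(ε)∖{0}" (full version p0030 L804–805)] -/
theorem initialForm_of_coeff_zero_ne_zero {f : MvPolynomial (Fin n) K} (h : coeff 0 f ≠ 0) :
    initialForm f = C (coeff 0 f) := by
  have hf : f ≠ 0 := fun hf => h (by rw [hf, coeff_zero])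
  rw [initialForm, (ldeg_eq_zero_iff hf).mpr h, homogeneousComponent_zero]

namespace ExactTerm

/-- `in(num_T) = C c · in(𝒫.p)` with `c = κ · (∏num)(0) · Π_𝒬(0) ≠ 0`.
[cite: DuttaDwivediSaxena2022, §3 induction hypothesis (3) "U_{i,j}|_{z=0} ∈ F(ε)∖{0}" (full version p0030 L804–805)] -/
theorem initialForm_numPoly (T : ExactTerm K n) :
    ∃ c : K, c ≠ 0 ∧ initialForm T.numPoly = C c * initialForm T.P.p := by
  refine ⟨T.A.κ * coeff 0 (formProd T.A.num) * coeff 0 T.Q.den,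
    mul_ne_zero (mul_ne_zero T.A.hκ (coeff_zero_formProd_ne_zero T.A.hnum)) T.Q.coeff_zero_den_ne_zero,
    ?_⟩
  rw [ExactTerm.numPoly, initialForm_mul, initialForm_mul, initialForm_mul, initialForm_C',
    initialForm_of_coeff_zero_ne_zero (coeff_zero_formProd_ne_zero T.A.hnum),
    initialForm_of_coeff_zero_ne_zero T.Q.coeff_zero_den_ne_zero, C_mul, C_mul]
  ring

/-- `in(den_T) = C d · in(𝒬.p)` with `d = (∏den)(0) · Π_𝒫(0) ≠ 0`.
[cite: DuttaDwivediSaxena2022, §3 induction hypothesis (3) "V_{i,j}|_{z=0} ∈ F(ε)∖{0}" (full version p0030 L804–805)] -/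
theorem initialForm_denPoly (T : ExactTerm K n) :
    ∃ d : K, d ≠ 0 ∧ initialForm T.denPoly = C d * initialForm T.Q.p := by
  refine ⟨coeff 0 (formProd T.A.den) * coeff 0 T.P.den,
    mul_ne_zero (coeff_zero_formProd_ne_zero T.A.hden) T.P.coeff_zero_den_ne_zero, ?_⟩
  rw [ExactTerm.denPoly, initialForm_mul, initialForm_mul,
    initialForm_of_coeff_zero_ne_zero (coeff_zero_formProd_ne_zero T.A.hden),
    initialForm_of_coeff_zero_ne_zero T.P.coeff_zero_den_ne_zero, C_mul]
  ring

end ExactTerm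

end InitialForms

/-! ## §2 Uniform `𝒬`: all terms of a stage carry the same `𝒬`-record -/

section UniformQ

variable {K : Type*} [Field K] {n : ℕ}

/-- At stage `0` all terms have `𝒬 = 1` ("`Q_{i,0} = 1`"), so `𝒬` is uniform.
[cite: DuttaDwivediSaxena2022, §3 proof of Thm. 3.2, base case "V_{i,0} := P_{i,0} := Q_{i,0} = 1" (full version p0028 L748–750)] -/
theorem uniformQ_of_ofLiveTerm {k d m : ℕ} {α : Fin k → Fin d → Option (Fin n) → K}
    {G : Fin m → ExactTerm K n}
    (hG : ∀ i, ∃ (i' : Fin k) (h : LiveTerm (α i')), G i = ofLiveTerm (α i') h) :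
    ∀ i i', (G i).Q = (G i').Q := by
  have h1 : ∀ i, (G i).Q = FracPair.ofPoly 1 := by
    intro i
    obtain ⟨i', h, hGi⟩ := hG i
    rw [hGi, ofLiveTerm, ExactTerm.ofForms]
  intro i i'
  rw [h1, h1]

/-- **Uniform `𝒬` along a sigma-typed DiDIL run** (round shape of
`DDS21TranscriptResidues.exists_didil_run`).
[cite: DuttaDwivediSaxena2022, §3 proof of Thm. 3.2, the induction over j (full version p0030 L797–812)] -/
theorem uniformQ_run {r : ℕ} {Fam : ℕ → (Σ m' : ℕ, Fin m' → ExactTerm K n)}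
    (hstep : ∀ j, j < r → ∃ (m' : ℕ) (G' : Fin (m' + 1) → ExactTerm K n) (i₀ : Fin (m' + 1)),
      Fam j = ⟨m' + 1, G'⟩ ∧ Fam (j + 1) = ⟨m', didilStep (euler (Fin n) K) G' i₀⟩)
    (h0 : ∀ i i', ((Fam 0).2 i).Q = ((Fam 0).2 i').Q) :
    ∀ j, j ≤ r → ∀ i i', ((Fam j).2 i).Q = ((Fam j).2 i').Q := by
  intro j
  induction j with
  | zero => exact fun _ => h0
  | succ j ih =>
    intro hj
    obtain ⟨m', G', i₀, hFj, hFj1⟩ := hstep j (Nat.lt_of_succ_le hj)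
    have hG' : ∀ i i', (G' i).Q = (G' i').Q := by
      have h := ih (Nat.le_of_succ_le hj)
      rw [hFj] at h
      exact h
    rw [hFj1]
    exact didilStep_Q_eq _ G' i₀ hG'

end UniformQ

/-! ## §3 The `z = 0` pieces and the slice as ONE quotient of `Σ∧Σ` circuits -/

section Slice

variable {F : Type*} [Field F] {n : ℕ} {F' : Type*} [Field F'] [Algebra F F']
  [Algebra (MvPolynomial (Fin n) F) F'] [IsScalarTower F (MvPolynomial (Fin n) F) F']

/-- ★ **The `z = 0` piece of one term** under uniform `𝒬`: `(T_i/T_{i₀})|_{z=0} =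
C r_i · in(P_i.p) / in(P_{i₀}.p)` (the constants and the common `in(𝒬.p)` cancel; a degenerate
term gives `r_i = 0`). [cite: DuttaDwivediSaxena2022, Claim 3.8 proof, second displayed line (full version p0035 L938–939)] -/
theorem exists_gradeZero_piece
    (hinj : Function.Injective (algebraMap (MvPolynomial (Fin n) F) F'))
    {a b a' b' : ℕ} {T S : ExactTerm (RatFunc F') n}
    (hT : ExactTerm.Companion (ratFuncMap (algebraMap F F'))
      (fun m => algebraMap F' (RatFunc F') (algebraMap (MvPolynomial (Fin n) F) F' (X m))) a b T)
    (hS : ExactTerm.Companion (ratFuncMap (algebraMap F F'))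
      (fun m => algebraMap F' (RatFunc F') (algebraMap (MvPolynomial (Fin n) F) F' (X m))) a' b' S)
    (hbal : a + b' = b + a') (hTw : T.WF) (hSw : S.WF) (hSn : S.ND) (hQ : T.Q = S.Q) :
    ∃ r : RatFunc F', GradeZero (T.val / S.val)
      (algebraMap (MvPolynomial (Fin n) (RatFunc F')) (FractionRing (MvPolynomial (Fin n) (RatFunc F')))
          (C r * initialForm T.P.p) /
        algebraMap (MvPolynomial (Fin n) (RatFunc F')) (FractionRing (MvPolynomial (Fin n) (RatFunc F')))
          (initialForm S.P.p)) := by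
  set am := algebraMap (MvPolynomial (Fin n) (RatFunc F'))
    (FractionRing (MvPolynomial (Fin n) (RatFunc F'))) with ham
  by_cases hTn : T.ND
  · obtain ⟨cT, hcT, hnumT⟩ := T.initialForm_numPoly
    obtain ⟨cS, hcS, hnumS⟩ := S.initialForm_numPoly
    obtain ⟨dT, hdT, hdenT⟩ := T.initialForm_denPoly
    obtain ⟨dS, hdS, hdenS⟩ := S.initialForm_denPoly
    refine ⟨cT * dS / (dT * cS), ?_⟩
    have h := hT.gradeZero_div_of_nd hinj hS hbal hTw hTn hSw hSn
    rw [hnumT, hnumS, hdenT, hdenS, hQ] at h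
    have hq : am (initialForm S.Q.p) ≠ 0 := algebraMap_frac_ne_zero (initialForm_ne_zero hSw)
    have hp : am (initialForm S.P.p) ≠ 0 := algebraMap_frac_ne_zero (initialForm_ne_zero hSn)
    have hcS' : am (C cS) ≠ 0 := algebraMap_frac_ne_zero (C_eq_zero.not.mpr hcS)
    have hdT' : am (C dT) ≠ 0 := algebraMap_frac_ne_zero (C_eq_zero.not.mpr hdT)
    have e : am (C cT * initialForm T.P.p * (C dS * initialForm S.Q.p)) /
          am (C dT * initialForm S.Q.p * (C cS * initialForm S.P.p)) =
        am (C (cT * dS / (dT * cS)) * initialForm T.P.p) / am (initialForm S.P.p) := by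
      have hC : am (C (cT * dS / (dT * cS))) * (am (C dT) * am (C cS)) = am (C cT) * am (C dS) := by
        simp only [← map_mul]
        rw [div_mul_cancel₀ _ (mul_ne_zero hdT hcS)]
      have hb : am (C dT * initialForm S.Q.p * (C cS * initialForm S.P.p)) ≠ 0 := by
        rw [map_mul, map_mul, map_mul]
        exact mul_ne_zero (mul_ne_zero hdT' hq) (mul_ne_zero hcS' hp)
      rw [div_eq_div_iff hb hp]
      simp only [map_mul]
      linear_combination (-(am (initialForm T.P.p) * am (initialForm S.Q.p) * am (initialForm S.P.p))) * hC
    rw [e] at h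
    exact h
  · refine ⟨0, ?_⟩
    rw [C_0, zero_mul, map_zero, zero_div]
    exact ExactTerm.gradeZero_div_of_not_nd hTw hTn

/-- ★ **The stage slice is one quotient of `Σ∧Σ` circuits.** For a stage family with uniform `𝒬`,
the value `w = (λ·(Σ_i T_i)/T_{i₀})|_{z=0}` is `Wn/Wd` with
`Wn = C λ · Σ_i C r_i · in(P_i.p) ∈ swsClass ((m+1)·t) B` and `Wd = in(P_{i₀}.p) ∈ swsClass ((m+1)·t) B`,
`Wd ≠ 0` ("`∈ Σ_i F(ε)·(Σ∧Σ/Σ∧Σ)`" — here with a COMMON `Σ∧Σ` denominator).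
[cite: DuttaDwivediSaxena2022, Claim 3.8 proof, "(…)|_{z=0} ∈ lim Σ_i F(ε)·(Σ∧Σ/Σ∧Σ) = lim (Σ∧Σ/Σ∧Σ)" (full version p0035 L938–939)] -/
theorem exists_gradeZero_slice_sws
    (hinj : Function.Injective (algebraMap (MvPolynomial (Fin n) F) F'))
    {m e : ℕ} {G : Fin (m + 1) → ExactTerm (RatFunc F') n} (hWF : ∀ i, (G i).WF) {i₀ : Fin (m + 1)}
    (hND : (G i₀).ND)
    (hcomp : StageComp (ratFuncMap (algebraMap F F'))
      (fun m => algebraMap F' (RatFunc F') (algebraMap (MvPolynomial (Fin n) F) F' (X m))) e G)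
    (hQ : ∀ i, (G i).Q = (G i₀).Q) {N t B : ℕ} (hcert : ∀ i, (G i).Cert N t)
    (hB : ∀ i, (G i).Bdd B) (hBN : B < N) (lam : RatFunc F') :
    ∃ Wn Wd : MvPolynomial (Fin n) (RatFunc F'),
      Wn ∈ swsClass (RatFunc F') n ((m + 1) * t) B ∧ Wd ∈ swsClass (RatFunc F') n ((m + 1) * t) B ∧
      Wd ≠ 0 ∧
      GradeZero (algebraMap (RatFunc F') (FractionRing (MvPolynomial (Fin n) (RatFunc F'))) lam *
          (∑ i, (G i).val) / (G i₀).val)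
        (algebraMap (MvPolynomial (Fin n) (RatFunc F')) (FractionRing (MvPolynomial (Fin n) (RatFunc F'))) Wn /
          algebraMap (MvPolynomial (Fin n) (RatFunc F')) (FractionRing (MvPolynomial (Fin n) (RatFunc F'))) Wd) := by
  classical
  set am := algebraMap (MvPolynomial (Fin n) (RatFunc F'))
    (FractionRing (MvPolynomial (Fin n) (RatFunc F'))) with ham
  -- the pieces
  obtain ⟨c₀, hc₀⟩ := hcomp i₀
  have hpiece : ∀ i, ∃ r : RatFunc F', GradeZero ((G i).val / (G i₀).val)
      (am (C r * initialForm (G i).P.p) / am (initialForm (G i₀).P.p)) := by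
    intro i
    obtain ⟨c, hc⟩ := hcomp i
    exact exists_gradeZero_piece hinj hc hc₀ (by omega) (hWF i) (hWF i₀) hND (hQ i)
  choose r hr using hpiece
  -- in(P_i.p) ∈ Σ∧Σ(t, B)
  have hin : ∀ i, initialForm (G i).P.p ∈ swsClass (RatFunc F') n t B := fun i => by
    have hl : ldeg (G i).P.p ≤ B := (ldeg_le_totalDegree _).trans (hB i).2.2.1
    exact swsClass_mono le_rfl hl
      (initialForm_mem_swsClass_of_cert (hcert i).1 (lt_of_le_of_lt hl hBN))
  refine ⟨C lam * ∑ i, C (r i) * initialForm (G i).P.p, initialForm (G i₀).P.p, ?_, ?_,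
    initialForm_ne_zero hND, ?_⟩
  · apply C_mul_mem_swsClass
    have h := sum_mem_swsClass Finset.univ (fun i => C (r i) * initialForm (G i).P.p)
      fun i _ => C_mul_mem_swsClass _ (hin i)
    rwa [Finset.card_univ, Fintype.card_fin] at h
  · exact swsClass_mono (Nat.le_mul_of_pos_left t (Nat.succ_pos m)) le_rfl (hin i₀)
  · have hsum := gradeZero_sum Finset.univ fun i _ => hr i
    have hY : algebraMap (RatFunc F') (FractionRing (MvPolynomial (Fin n) (RatFunc F'))) lam *
          (∑ i, (G i).val) / (G i₀).val =
        am (C lam) * ∑ i, (G i).val / (G i₀).val := by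
      rw [IsScalarTower.algebraMap_apply (RatFunc F') (MvPolynomial (Fin n) (RatFunc F'))
        (FractionRing (MvPolynomial (Fin n) (RatFunc F'))) lam, MvPolynomial.algebraMap_eq, ← ham,
        mul_div_assoc, Finset.sum_div]
    have hw : am (C lam * ∑ i, C (r i) * initialForm (G i).P.p) / am (initialForm (G i₀).P.p) =
        am (C lam) * ∑ i, am (C (r i) * initialForm (G i).P.p) / am (initialForm (G i₀).P.p) := by
      rw [map_mul, map_sum, mul_div_assoc, Finset.sum_div]
    rw [hY, hw]
    exact hsum.C_mul lam

end Slice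

/-! ## §4 De-bordering the slice: small ABPs for `(f_j/t_{k−j,j})|_{z=0}` -/

section Programs

variable {F : Type*} [Field F] {n : ℕ} {F' : Type*} [Field F'] [CharZero F'] [Algebra F F']
  [Algebra (MvPolynomial (Fin n) F) F'] [IsScalarTower F (MvPolynomial (Fin n) F) F']

omit [CharZero F'] [Algebra F F'] [Algebra (MvPolynomial (Fin n) F) F']
  [IsScalarTower F (MvPolynomial (Fin n) F) F'] in
/-- Members of `\overline{Σ∧Σ(t, e)}` have total degree `≤ e` (approximation does not raise
degrees). (folklore) [cite: DuttaDwivediSaxena2022, Def. 2.1 (full version p0016 L416–419)] -/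
theorem totalDegree_le_of_mem_border_swsClass {t e : ℕ} {f : MvPolynomial (Fin n) F'}
    (hf : f ∈ border (swsClass (RatFunc F') n t e)) : f.totalDegree ≤ e := by
  obtain ⟨G, hG, rfl⟩ := mem_border_iff.mp hf
  have h1 : (map (Polynomial.constantCoeff : F'[X] →+* F') G).totalDegree ≤ G.totalDegree :=
    Finset.sup_mono (support_map_subset _ G)
  have h2 : G.totalDegree = (map (algebraMap F'[X] (RatFunc F')) G).totalDegree := by
    rw [totalDegree, totalDegree, support_map_of_injective _ (RatFunc.algebraMap_injective F')]
  exact h1.trans (h2 ▸ totalDegree_le_of_mem_swsClass hG)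

/-- ★★ **THE `z = 0` SLICE OF A DiDIL STAGE HAS SMALL ABPs (Claim 3.8).** For a well-formed stage
family `G` over `F′(ε)` (`F′ ⊇ F[y]`, generic point) with nondegenerate divisor `G i₀`, the
companion invariant, uniform `𝒬`, `Σ∧Σ` certificates below degree `N` with fan-in `t`, sizes `≤ B`,
`B < N`, and the Claim-3.8 datum `lim_{ε→0} (λ·(Σ_i T_i)/T_{i₀}) = r`: the `z = 0` slice of `r`
exists and is `Nw/ew` with `ew ≠ 0`, both computed by univariate-labelled layered ABPs within the
explicit budget and of total degree `≤ B`: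
"`(f_j/t)|_{z=0} = lim Σ_i (T_{i,j}/T̃)|_{z=0} ∈ lim (Σ∧Σ/Σ∧Σ) ⊆ ARO/ARO ⊆ ABP/ABP`".
[cite: DuttaDwivediSaxena2022, Claim 3.8 with proof (full version p0035 L934–941); Lemma 2.23 (p0025 L661–664); §3 end of Thm. 3.2's proof, the limit step (p0036 L938–943)] -/
theorem exists_sliceZero_programs
    (hinj : Function.Injective (algebraMap (MvPolynomial (Fin n) F) F'))
    {m e : ℕ} {G : Fin (m + 1) → ExactTerm (RatFunc F') n} (hWF : ∀ i, (G i).WF) {i₀ : Fin (m + 1)}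
    (hND : (G i₀).ND)
    (hcomp : StageComp (ratFuncMap (algebraMap F F'))
      (fun m => algebraMap F' (RatFunc F') (algebraMap (MvPolynomial (Fin n) F) F' (X m))) e G)
    (hQ : ∀ i, (G i).Q = (G i₀).Q) {N t B : ℕ} (hcert : ∀ i, (G i).Cert N t)
    (hB : ∀ i, (G i).Bdd B) (hBN : B < N) (lam : RatFunc F')
    {r : FractionRing (MvPolynomial (Fin n) F')}
    (hY : EpsLim (algebraMap (RatFunc F') (FractionRing (MvPolynomial (Fin n) (RatFunc F'))) lam *
      (∑ i, (G i).val) / (G i₀).val) r) :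
    ∃ Nw ew : MvPolynomial (Fin n) F', ew ≠ 0 ∧
      GradeZero r (limToFrac F' (Fin n) Nw / limToFrac F' (Fin n) ew) ∧
      UABPComputes ((n + 1) * ((m + 1) * t * ((n + 1) * B + 1)) + B + 2 + 2) Nw ∧
      UABPComputes ((n + 1) * ((m + 1) * t * ((n + 1) * B + 1)) + B + 2 + 2) ew ∧
      Nw.totalDegree ≤ B ∧ ew.totalDegree ≤ B := by
  set am := algebraMap (MvPolynomial (Fin n) (RatFunc F'))
    (FractionRing (MvPolynomial (Fin n) (RatFunc F'))) with ham
  obtain ⟨Wn, Wd, hWn, hWd, hWd0, hw⟩ :=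
    exists_gradeZero_slice_sws hinj hWF hND hcomp hQ hcert hB hBN lam
  obtain ⟨w₀, hw₀⟩ := exists_gradeZero_lim_stage' hinj hWF hND hcomp lam hY
  have hlim : EpsLim (am Wn / am Wd) w₀ := epsLim_gradeZero_stage' hinj hWF hND hcomp lam hY hw hw₀
  obtain ⟨M, E, hE, hmodel, hr⟩ := hlim
  -- cleared form `Wn · ι(E) = ι(M) · Wd`
  have heq : Wn * map (algebraMap F'[X] (RatFunc F')) E = map (algebraMap F'[X] (RatFunc F')) M * Wd := by
    apply algebraMap_frac_injective
    rw [map_mul, map_mul, ← intToFrac_apply, ← intToFrac_apply, ← hmodel, ← ham,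
      div_mul_eq_mul_div, div_mul_cancel₀ _ (algebraMap_frac_ne_zero hWd0)]
  have hE' : map (Polynomial.constantCoeff : F'[X] →+* F') E ≠ 0 := by rwa [← redZero_apply]
  obtain ⟨P₀, Q₀, hP₀, hQ₀, hQ₀0, u, hu, hu0⟩ := border_div_swsClass hWn hWd hWd0 hE' heq
  rw [← redZero_apply, ← redZero_apply] at hu
  -- `w₀ = C u · P₀ / Q₀`
  have hw₀eq : w₀ = limToFrac F' (Fin n) (C u * P₀) / limToFrac F' (Fin n) Q₀ := by
    have hE0 : limToFrac F' (Fin n) (redZero F' (Fin n) E) ≠ 0 := limToFrac_ne_zero hE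
    have hQ0 : limToFrac F' (Fin n) Q₀ ≠ 0 := limToFrac_ne_zero hQ₀0
    rw [eq_div_iff hQ0]
    apply mul_right_cancel₀ hE0
    calc w₀ * limToFrac F' (Fin n) Q₀ * limToFrac F' (Fin n) (redZero F' (Fin n) E)
        = w₀ * limToFrac F' (Fin n) (redZero F' (Fin n) E) * limToFrac F' (Fin n) Q₀ := by ring
      _ = limToFrac F' (Fin n) (redZero F' (Fin n) M * Q₀) := by rw [hr, map_mul]
      _ = limToFrac F' (Fin n) (C u * P₀) * limToFrac F' (Fin n) (redZero F' (Fin n) E) := by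
          rw [hu, map_mul]
  refine ⟨C u * P₀, Q₀, hQ₀0, hw₀eq ▸ hw₀, ?_, ?_, ?_, ?_⟩
  · exact (uabpComputes_of_mem_border_swsClass hP₀).smul_C u
  · exact (uabpComputes_of_mem_border_swsClass hQ₀).mono (by omega)
  · refine (totalDegree_mul _ _).trans ?_
    rw [totalDegree_C, zero_add]
    exact totalDegree_le_of_mem_border_swsClass hP₀
  · exact totalDegree_le_of_mem_border_swsClass hQ₀

/-- ★★ The `σ`-form of `exists_sliceZero_programs` in the consumer's binder currency
(`DDS21ResidueChainExists`): programs of size `≤ σ^15` and degrees `≤ σ^15` when `2 ≤ σ`,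
`n + 1 ≤ σ`, `t ≤ σ`, `B ≤ σ`, `m + 1 ≤ σ` (Lemma 2.23 as `uabpComputes_of_mem_border_swsClass_le`
at `s := σ²`, since the numerator class has fan-in `(m+1)·t ≤ σ²`). The exponent does NOT depend
on the number of terms (uniform `𝒬`).
[cite: DuttaDwivediSaxena2022, Claim 3.8 (full version p0035 L934–941); Lemma 2.23 (p0025 L661–664)] -/
theorem exists_sliceZero_programs_le
    (hinj : Function.Injective (algebraMap (MvPolynomial (Fin n) F) F'))
    {m e : ℕ} {G : Fin (m + 1) → ExactTerm (RatFunc F') n} (hWF : ∀ i, (G i).WF) {i₀ : Fin (m + 1)}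
    (hND : (G i₀).ND)
    (hcomp : StageComp (ratFuncMap (algebraMap F F'))
      (fun m => algebraMap F' (RatFunc F') (algebraMap (MvPolynomial (Fin n) F) F' (X m))) e G)
    (hQ : ∀ i, (G i).Q = (G i₀).Q) {N t B σ : ℕ} (hcert : ∀ i, (G i).Cert N t)
    (hB : ∀ i, (G i).Bdd B) (hBN : B < N) (hσ : 2 ≤ σ) (hn : n + 1 ≤ σ) (ht : t ≤ σ)
    (hBσ : B ≤ σ) (hm : m + 1 ≤ σ) (lam : RatFunc F')
    {r : FractionRing (MvPolynomial (Fin n) F')}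
    (hY : EpsLim (algebraMap (RatFunc F') (FractionRing (MvPolynomial (Fin n) (RatFunc F'))) lam *
      (∑ i, (G i).val) / (G i₀).val) r) :
    ∃ Nw ew : MvPolynomial (Fin n) F', ew ≠ 0 ∧
      GradeZero r (limToFrac F' (Fin n) Nw / limToFrac F' (Fin n) ew) ∧
      UABPComputes (σ ^ 15) Nw ∧ UABPComputes (σ ^ 15) ew ∧
      Nw.totalDegree ≤ σ ^ 15 ∧ ew.totalDegree ≤ σ ^ 15 := by
  set am := algebraMap (MvPolynomial (Fin n) (RatFunc F'))
    (FractionRing (MvPolynomial (Fin n) (RatFunc F'))) with ham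
  obtain ⟨Wn, Wd, hWn, hWd, hWd0, hw⟩ :=
    exists_gradeZero_slice_sws hinj hWF hND hcomp hQ hcert hB hBN lam
  obtain ⟨w₀, hw₀⟩ := exists_gradeZero_lim_stage' hinj hWF hND hcomp lam hY
  have hlim : EpsLim (am Wn / am Wd) w₀ := epsLim_gradeZero_stage' hinj hWF hND hcomp lam hY hw hw₀
  obtain ⟨M, E, hE, hmodel, hr⟩ := hlim
  have heq : Wn * map (algebraMap F'[X] (RatFunc F')) E = map (algebraMap F'[X] (RatFunc F')) M * Wd := by
    apply algebraMap_frac_injective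
    rw [map_mul, map_mul, ← intToFrac_apply, ← intToFrac_apply, ← hmodel, ← ham,
      div_mul_eq_mul_div, div_mul_cancel₀ _ (algebraMap_frac_ne_zero hWd0)]
  have hE' : map (Polynomial.constantCoeff : F'[X] →+* F') E ≠ 0 := by rwa [← redZero_apply]
  obtain ⟨P₀, Q₀, hP₀, hQ₀, hQ₀0, u, hu, hu0⟩ := border_div_swsClass hWn hWd hWd0 hE' heq
  rw [← redZero_apply, ← redZero_apply] at hu
  have hw₀eq : w₀ = limToFrac F' (Fin n) (C u * P₀) / limToFrac F' (Fin n) Q₀ := by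
    have hE0 : limToFrac F' (Fin n) (redZero F' (Fin n) E) ≠ 0 := limToFrac_ne_zero hE
    have hQ0 : limToFrac F' (Fin n) Q₀ ≠ 0 := limToFrac_ne_zero hQ₀0
    rw [eq_div_iff hQ0]
    apply mul_right_cancel₀ hE0
    calc w₀ * limToFrac F' (Fin n) Q₀ * limToFrac F' (Fin n) (redZero F' (Fin n) E)
        = w₀ * limToFrac F' (Fin n) (redZero F' (Fin n) E) * limToFrac F' (Fin n) Q₀ := by ring
      _ = limToFrac F' (Fin n) (redZero F' (Fin n) M * Q₀) := by rw [hr, map_mul]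
      _ = limToFrac F' (Fin n) (C u * P₀) * limToFrac F' (Fin n) (redZero F' (Fin n) E) := by
          rw [hu, map_mul]
  -- Lemma 2.23 at `s := σ²`: `(m+1)·t ≤ σ²`, `B ≤ σ²`, `n ≤ σ²`, `2 ≤ σ²`
  have hσσ : σ ≤ σ ^ 2 := Nat.le_self_pow (by norm_num) σ
  have ht2 : (m + 1) * t ≤ σ ^ 2 := by
    rw [sq]; exact Nat.mul_le_mul hm ht
  have hB2 : B ≤ σ ^ 2 := hBσ.trans hσσ
  have hn2 : n ≤ σ ^ 2 := (Nat.le_succ n).trans (hn.trans hσσ)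
  have hs2 : 2 ≤ σ ^ 2 := hσ.trans hσσ
  -- `(σ²)^7 + 2 ≤ σ^15`, `B ≤ σ^15`
  have hpow : (σ ^ 2) ^ 7 + 2 ≤ σ ^ 15 := by
    have h14 : 2 ≤ σ ^ 14 := hσ.trans (Nat.le_self_pow (by norm_num) σ)
    calc (σ ^ 2) ^ 7 + 2 = σ ^ 14 + 2 := by ring
      _ ≤ σ ^ 14 + σ ^ 14 := by omega
      _ = σ ^ 14 * 2 := by ring
      _ ≤ σ ^ 14 * σ := Nat.mul_le_mul_left _ hσ
      _ = σ ^ 15 := by ring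
  have hB15 : B ≤ σ ^ 15 := hBσ.trans (Nat.le_self_pow (by norm_num) σ)
  refine ⟨C u * P₀, Q₀, hQ₀0, hw₀eq ▸ hw₀, ?_, ?_, ?_, ?_⟩
  · exact ((uabpComputes_of_mem_border_swsClass_le hP₀ ht2 hB2 hn2 hs2).smul_C u).mono hpow
  · exact (uabpComputes_of_mem_border_swsClass_le hQ₀ ht2 hB2 hn2 hs2).mono (by omega)
  · refine (totalDegree_mul _ _).trans ?_
    rw [totalDegree_C, zero_add]
    exact (totalDegree_le_of_mem_border_swsClass hP₀).trans hB15
  · exact (totalDegree_le_of_mem_border_swsClass hQ₀).trans hB15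

end Programs

end DDS2021

end Literature.Computability.AlgebraicComplexity

end
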